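import Mathlib
import HarnessLib
import Summits.RiemannHypothesis.RiemannHypothesis.Theorems.DbrWallLogTableA

/-!
# DBR column, rung B-P(P1): two-sided rational enclosures of `log p`, primes `p ≤ 131` (part B: 71 ≤ p ≤ 131)

RH-FREE elementary inequalities (LINE 1 of the label discipline): for each prime `p` in range a lemma
`log_<p>_bounds : lo < Real.log p ∧ Real.log p < hi` with 13-decimal rational `lo, hi` (widths `≤ 1e-12`),
each obtained from Mathlib's `Real.abs_log_sub_add_sum_range_le` (the logarithmic series with remainder)
applied to `log(p/N)` for a smooth neighbour `N` of `p`, plus the bounds already proved for the primes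
dividing `N`. They feed the generic anti-persistence rung certificate (`DbrWallRungKit`): the prime terms
`Λ(n)n^{-1/2}(log q' − log n)` of the two-point gap `2Ψ(s) − Ψ(2s)` at `s = (log q')/2` are bounded below
from these enclosures. Nothing here bears on the truth of RH. [folklore]
-/

set_option linter.dupNamespace false

noncomputable section

namespace Summit.RiemannHypothesis.RiemannHypothesis.Theorems.DbrWall.LogTable

/-- `4.2626798770409 < log 71 < 4.2626798770419` (from `log(71 / 72)` by 7 terms of the logarithmic series; width 1.0e-12). [folklore] -/
theorem log_seventyone_bounds : (4.2626798770409 : ℝ) < Real.log 71 ∧ Real.log 71 < 4.2626798770419 := by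
  have hx : |(1 / 72 : ℝ)| < 1 := by rw [abs_of_pos (by norm_num)]; norm_num
  have h := Real.abs_log_sub_add_sum_range_le hx 7
  have hN : Real.log (72 : ℝ) = 3 * Real.log 2 + 2 * Real.log 3 := by
    rw [show (72 : ℝ) = 2 ^ 3 * 3 ^ 2 by norm_num]
    rw [Real.log_mul (by positivity) (by positivity)]
    simp only [Real.log_pow]; push_cast; ring
  have e : Real.log (1 - 1 / 72 : ℝ) = Real.log 71 - (3 * Real.log 2 + 2 * Real.log 3) := by
    rw [show (1 - 1 / 72 : ℝ) = (71 : ℝ) / 72 by norm_num, Real.log_div (by norm_num) (by norm_num), hN]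
  rw [e, abs_of_pos (by norm_num : (0:ℝ) < 1 / 72)] at h
  obtain ⟨hl, hu⟩ := abs_le.1 h
  simp only [Finset.sum_range_succ, Finset.sum_range_zero] at hl hu
  norm_num at hl hu
  have hb2 := log_two_bounds
  have hb3 := log_three_bounds
  constructor <;> linarith

/-- `4.2904594411479 < log 73 < 4.2904594411490` (from `log(71 / 73)` by 8 terms of the logarithmic series; width 1.1e-12). [folklore] -/
theorem log_seventythree_bounds : (4.2904594411479 : ℝ) < Real.log 73 ∧ Real.log 73 < 4.2904594411490 := by
  have hx : |(2 / 73 : ℝ)| < 1 := by rw [abs_of_pos (by norm_num)]; norm_num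
  have h := Real.abs_log_sub_add_sum_range_le hx 8
  have e : Real.log (1 - 2 / 73 : ℝ) = (Real.log 71) - Real.log 73 := by
    rw [show (1 - 2 / 73 : ℝ) = (71 : ℝ) / 73 by norm_num, Real.log_div (by norm_num) (by norm_num)]
  rw [e, abs_of_pos (by norm_num : (0:ℝ) < 2 / 73)] at h
  obtain ⟨hl, hu⟩ := abs_le.1 h
  simp only [Finset.sum_range_succ, Finset.sum_range_zero] at hl hu
  norm_num at hl hu
  have hb71 := log_seventyone_bounds
  constructor <;> linarith

/-- `4.3694478524665 < log 79 < 4.3694478524678` (from `log(79 / 81)` by 8 terms of the logarithmic series; width 1.3e-12). [folklore] -/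
theorem log_seventynine_bounds : (4.3694478524665 : ℝ) < Real.log 79 ∧ Real.log 79 < 4.3694478524678 := by
  have hx : |(2 / 81 : ℝ)| < 1 := by rw [abs_of_pos (by norm_num)]; norm_num
  have h := Real.abs_log_sub_add_sum_range_le hx 8
  have hN : Real.log (81 : ℝ) = 4 * Real.log 3 := by
    rw [show (81 : ℝ) = 3 ^ 4 by norm_num]
    simp only [Real.log_pow]; push_cast; ring
  have e : Real.log (1 - 2 / 81 : ℝ) = Real.log 79 - (4 * Real.log 3) := by
    rw [show (1 - 2 / 81 : ℝ) = (79 : ℝ) / 81 by norm_num, Real.log_div (by norm_num) (by norm_num), hN]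
  rw [e, abs_of_pos (by norm_num : (0:ℝ) < 2 / 81)] at h
  obtain ⟨hl, hu⟩ := abs_le.1 h
  simp only [Finset.sum_range_succ, Finset.sum_range_zero] at hl hu
  norm_num at hl hu
  have hb3 := log_three_bounds
  constructor <;> linarith

/-- `4.4188406077961 < log 83 < 4.4188406077974` (from `log(81 / 83)` by 8 terms of the logarithmic series; width 1.3e-12). [folklore] -/
theorem log_eightythree_bounds : (4.4188406077961 : ℝ) < Real.log 83 ∧ Real.log 83 < 4.4188406077974 := by
  have hx : |(2 / 83 : ℝ)| < 1 := by rw [abs_of_pos (by norm_num)]; norm_num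
  have h := Real.abs_log_sub_add_sum_range_le hx 8
  have hN : Real.log (81 : ℝ) = 4 * Real.log 3 := by
    rw [show (81 : ℝ) = 3 ^ 4 by norm_num]
    simp only [Real.log_pow]; push_cast; ring
  have e : Real.log (1 - 2 / 83 : ℝ) = (4 * Real.log 3) - Real.log 83 := by
    rw [show (1 - 2 / 83 : ℝ) = (81 : ℝ) / 83 by norm_num, Real.log_div (by norm_num) (by norm_num), hN]
  rw [e, abs_of_pos (by norm_num : (0:ℝ) < 2 / 83)] at h
  obtain ⟨hl, hu⟩ := abs_le.1 h
  simp only [Finset.sum_range_succ, Finset.sum_range_zero] at hl hu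
  norm_num at hl hu
  have hb3 := log_three_bounds
  constructor <;> linarith

/-- `4.4886363697318 < log 89 < 4.4886363697327` (from `log(88 / 89)` by 7 terms of the logarithmic series; width 9.0e-13). [folklore] -/
theorem log_eightynine_bounds : (4.4886363697318 : ℝ) < Real.log 89 ∧ Real.log 89 < 4.4886363697327 := by
  have hx : |(1 / 89 : ℝ)| < 1 := by rw [abs_of_pos (by norm_num)]; norm_num
  have h := Real.abs_log_sub_add_sum_range_le hx 7
  have hN : Real.log (88 : ℝ) = 3 * Real.log 2 + Real.log 11 := by
    rw [show (88 : ℝ) = 2 ^ 3 * 11 by norm_num]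
    rw [Real.log_mul (by positivity) (by positivity)]
    simp only [Real.log_pow]; push_cast; ring
  have e : Real.log (1 - 1 / 89 : ℝ) = (3 * Real.log 2 + Real.log 11) - Real.log 89 := by
    rw [show (1 - 1 / 89 : ℝ) = (88 : ℝ) / 89 by norm_num, Real.log_div (by norm_num) (by norm_num), hN]
  rw [e, abs_of_pos (by norm_num : (0:ℝ) < 1 / 89)] at h
  obtain ⟨hl, hu⟩ := abs_le.1 h
  simp only [Finset.sum_range_succ, Finset.sum_range_zero] at hl hu
  norm_num at hl hu
  have hb2 := log_two_bounds
  have hb11 := log_eleven_bounds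
  constructor <;> linarith

/-- `4.5747109785030 < log 97 < 4.5747109785039` (from `log(96 / 97)` by 7 terms of the logarithmic series; width 9.0e-13). [folklore] -/
theorem log_ninetyseven_bounds : (4.5747109785030 : ℝ) < Real.log 97 ∧ Real.log 97 < 4.5747109785039 := by
  have hx : |(1 / 97 : ℝ)| < 1 := by rw [abs_of_pos (by norm_num)]; norm_num
  have h := Real.abs_log_sub_add_sum_range_le hx 7
  have hN : Real.log (96 : ℝ) = 5 * Real.log 2 + Real.log 3 := by
    rw [show (96 : ℝ) = 2 ^ 5 * 3 by norm_num]
    rw [Real.log_mul (by positivity) (by positivity)]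
    simp only [Real.log_pow]; push_cast; ring
  have e : Real.log (1 - 1 / 97 : ℝ) = (5 * Real.log 2 + Real.log 3) - Real.log 97 := by
    rw [show (1 - 1 / 97 : ℝ) = (96 : ℝ) / 97 by norm_num, Real.log_div (by norm_num) (by norm_num), hN]
  rw [e, abs_of_pos (by norm_num : (0:ℝ) < 1 / 97)] at h
  obtain ⟨hl, hu⟩ := abs_le.1 h
  simp only [Finset.sum_range_succ, Finset.sum_range_zero] at hl hu
  norm_num at hl hu
  have hb2 := log_two_bounds
  have hb3 := log_three_bounds
  constructor <;> linarith

/-- `4.6151205168409 < log 101 < 4.6151205168418` (from `log(100 / 101)` by 6 terms of the logarithmic series; width 9.0e-13). [folklore] -/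
theorem log_hundredone_bounds : (4.6151205168409 : ℝ) < Real.log 101 ∧ Real.log 101 < 4.6151205168418 := by
  have hx : |(1 / 101 : ℝ)| < 1 := by rw [abs_of_pos (by norm_num)]; norm_num
  have h := Real.abs_log_sub_add_sum_range_le hx 6
  have hN : Real.log (100 : ℝ) = 2 * Real.log 2 + 2 * Real.log 5 := by
    rw [show (100 : ℝ) = 2 ^ 2 * 5 ^ 2 by norm_num]
    rw [Real.log_mul (by positivity) (by positivity)]
    simp only [Real.log_pow]; push_cast; ring
  have e : Real.log (1 - 1 / 101 : ℝ) = (2 * Real.log 2 + 2 * Real.log 5) - Real.log 101 := by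
    rw [show (1 - 1 / 101 : ℝ) = (100 : ℝ) / 101 by norm_num, Real.log_div (by norm_num) (by norm_num), hN]
  rw [e, abs_of_pos (by norm_num : (0:ℝ) < 1 / 101)] at h
  obtain ⟨hl, hu⟩ := abs_le.1 h
  simp only [Finset.sum_range_succ, Finset.sum_range_zero] at hl hu
  norm_num at hl hu
  have hb2 := log_two_bounds
  have hb5 := log_five_bounds
  constructor <;> linarith

/-- `4.6347289882292 < log 103 < 4.6347289882302` (from `log(103 / 104)` by 6 terms of the logarithmic series; width 1.0e-12). [folklore] -/
theorem log_hundredthree_bounds : (4.6347289882292 : ℝ) < Real.log 103 ∧ Real.log 103 < 4.6347289882302 := by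
  have hx : |(1 / 104 : ℝ)| < 1 := by rw [abs_of_pos (by norm_num)]; norm_num
  have h := Real.abs_log_sub_add_sum_range_le hx 6
  have hN : Real.log (104 : ℝ) = 3 * Real.log 2 + Real.log 13 := by
    rw [show (104 : ℝ) = 2 ^ 3 * 13 by norm_num]
    rw [Real.log_mul (by positivity) (by positivity)]
    simp only [Real.log_pow]; push_cast; ring
  have e : Real.log (1 - 1 / 104 : ℝ) = Real.log 103 - (3 * Real.log 2 + Real.log 13) := by
    rw [show (1 - 1 / 104 : ℝ) = (103 : ℝ) / 104 by norm_num, Real.log_div (by norm_num) (by norm_num), hN]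
  rw [e, abs_of_pos (by norm_num : (0:ℝ) < 1 / 104)] at h
  obtain ⟨hl, hu⟩ := abs_le.1 h
  simp only [Finset.sum_range_succ, Finset.sum_range_zero] at hl hu
  norm_num at hl hu
  have hb2 := log_two_bounds
  have hb13 := log_thirteen_bounds
  constructor <;> linarith

/-- `4.6728288344614 < log 107 < 4.6728288344625` (from `log(106 / 107)` by 6 terms of the logarithmic series; width 1.1e-12). [folklore] -/
theorem log_hundredseven_bounds : (4.6728288344614 : ℝ) < Real.log 107 ∧ Real.log 107 < 4.6728288344625 := by
  have hx : |(1 / 107 : ℝ)| < 1 := by rw [abs_of_pos (by norm_num)]; norm_num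
  have h := Real.abs_log_sub_add_sum_range_le hx 6
  have hN : Real.log (106 : ℝ) = Real.log 2 + Real.log 53 := by
    rw [show (106 : ℝ) = 2 * 53 by norm_num]
    rw [Real.log_mul (by positivity) (by positivity)]
  have e : Real.log (1 - 1 / 107 : ℝ) = (Real.log 2 + Real.log 53) - Real.log 107 := by
    rw [show (1 - 1 / 107 : ℝ) = (106 : ℝ) / 107 by norm_num, Real.log_div (by norm_num) (by norm_num), hN]
  rw [e, abs_of_pos (by norm_num : (0:ℝ) < 1 / 107)] at h
  obtain ⟨hl, hu⟩ := abs_le.1 h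
  simp only [Finset.sum_range_succ, Finset.sum_range_zero] at hl hu
  norm_num at hl hu
  have hb2 := log_two_bounds
  have hb53 := log_fiftythree_bounds
  constructor <;> linarith

/-- `4.6913478822287 < log 109 < 4.6913478822299` (from `log(108 / 109)` by 6 terms of the logarithmic series; width 1.2e-12). [folklore] -/
theorem log_hundrednine_bounds : (4.6913478822287 : ℝ) < Real.log 109 ∧ Real.log 109 < 4.6913478822299 := by
  have hx : |(1 / 109 : ℝ)| < 1 := by rw [abs_of_pos (by norm_num)]; norm_num
  have h := Real.abs_log_sub_add_sum_range_le hx 6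
  have hN : Real.log (108 : ℝ) = 2 * Real.log 2 + 3 * Real.log 3 := by
    rw [show (108 : ℝ) = 2 ^ 2 * 3 ^ 3 by norm_num]
    rw [Real.log_mul (by positivity) (by positivity)]
    simp only [Real.log_pow]; push_cast; ring
  have e : Real.log (1 - 1 / 109 : ℝ) = (2 * Real.log 2 + 3 * Real.log 3) - Real.log 109 := by
    rw [show (1 - 1 / 109 : ℝ) = (108 : ℝ) / 109 by norm_num, Real.log_div (by norm_num) (by norm_num), hN]
  rw [e, abs_of_pos (by norm_num : (0:ℝ) < 1 / 109)] at h
  obtain ⟨hl, hu⟩ := abs_le.1 h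
  simp only [Finset.sum_range_succ, Finset.sum_range_zero] at hl hu
  norm_num at hl hu
  have hb2 := log_two_bounds
  have hb3 := log_three_bounds
  constructor <;> linarith

/-- `4.7273878187119 < log 113 < 4.7273878187128` (from `log(112 / 113)` by 6 terms of the logarithmic series; width 9.0e-13). [folklore] -/
theorem log_hundredthirteen_bounds : (4.7273878187119 : ℝ) < Real.log 113 ∧ Real.log 113 < 4.7273878187128 := by
  have hx : |(1 / 113 : ℝ)| < 1 := by rw [abs_of_pos (by norm_num)]; norm_num
  have h := Real.abs_log_sub_add_sum_range_le hx 6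
  have hN : Real.log (112 : ℝ) = 4 * Real.log 2 + Real.log 7 := by
    rw [show (112 : ℝ) = 2 ^ 4 * 7 by norm_num]
    rw [Real.log_mul (by positivity) (by positivity)]
    simp only [Real.log_pow]; push_cast; ring
  have e : Real.log (1 - 1 / 113 : ℝ) = (4 * Real.log 2 + Real.log 7) - Real.log 113 := by
    rw [show (1 - 1 / 113 : ℝ) = (112 : ℝ) / 113 by norm_num, Real.log_div (by norm_num) (by norm_num), hN]
  rw [e, abs_of_pos (by norm_num : (0:ℝ) < 1 / 113)] at h
  obtain ⟨hl, hu⟩ := abs_le.1 h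
  simp only [Finset.sum_range_succ, Finset.sum_range_zero] at hl hu
  norm_num at hl hu
  have hb2 := log_two_bounds
  have hb7 := log_seven_bounds
  constructor <;> linarith

/-- `4.8441870864582 < log 127 < 4.8441870864590` (from `log(127 / 128)` by 6 terms of the logarithmic series; width 8.0e-13). [folklore] -/
theorem log_hundredtwentyseven_bounds : (4.8441870864582 : ℝ) < Real.log 127 ∧ Real.log 127 < 4.8441870864590 := by
  have hx : |(1 / 128 : ℝ)| < 1 := by rw [abs_of_pos (by norm_num)]; norm_num
  have h := Real.abs_log_sub_add_sum_range_le hx 6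
  have hN : Real.log (128 : ℝ) = 7 * Real.log 2 := by
    rw [show (128 : ℝ) = 2 ^ 7 by norm_num]
    simp only [Real.log_pow]; push_cast; ring
  have e : Real.log (1 - 1 / 128 : ℝ) = Real.log 127 - (7 * Real.log 2) := by
    rw [show (1 - 1 / 128 : ℝ) = (127 : ℝ) / 128 by norm_num, Real.log_div (by norm_num) (by norm_num), hN]
  rw [e, abs_of_pos (by norm_num : (0:ℝ) < 1 / 128)] at h
  obtain ⟨hl, hu⟩ := abs_le.1 h
  simp only [Finset.sum_range_succ, Finset.sum_range_zero] at hl hu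
  norm_num at hl hu
  have hb2 := log_two_bounds
  constructor <;> linarith

/-- `4.8751973232007 < log 131 < 4.8751973232018` (from `log(130 / 131)` by 6 terms of the logarithmic series; width 1.1e-12). [folklore] -/
theorem log_hundredthirtyone_bounds : (4.8751973232007 : ℝ) < Real.log 131 ∧ Real.log 131 < 4.8751973232018 := by
  have hx : |(1 / 131 : ℝ)| < 1 := by rw [abs_of_pos (by norm_num)]; norm_num
  have h := Real.abs_log_sub_add_sum_range_le hx 6
  have hN : Real.log (130 : ℝ) = Real.log 2 + Real.log 5 + Real.log 13 := by
    rw [show (130 : ℝ) = 2 * 5 * 13 by norm_num]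
    rw [Real.log_mul (by positivity) (by positivity), Real.log_mul (by positivity) (by positivity)]
  have e : Real.log (1 - 1 / 131 : ℝ) = (Real.log 2 + Real.log 5 + Real.log 13) - Real.log 131 := by
    rw [show (1 - 1 / 131 : ℝ) = (130 : ℝ) / 131 by norm_num, Real.log_div (by norm_num) (by norm_num), hN]
  rw [e, abs_of_pos (by norm_num : (0:ℝ) < 1 / 131)] at h
  obtain ⟨hl, hu⟩ := abs_le.1 h
  simp only [Finset.sum_range_succ, Finset.sum_range_zero] at hl hu
  norm_num at hl hu
  have hb2 := log_two_bounds
  have hb5 := log_five_bounds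
  have hb13 := log_thirteen_bounds
  constructor <;> linarith

end Summit.RiemannHypothesis.RiemannHypothesis.Theorems.DbrWall.LogTable
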